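import Summits.SmoothPoincare4.SmoothPoincare4.Theorems.SymplecticOrigamiGromovRecognitionRelEndStubFlatLeavesAux4
import Literature.Geometry.Symplectic.AlmostComplexStructure
import Literature.Geometry.Symplectic.JHolomorphicOn
import Mathlib.Geometry.Manifold.LocalDiffeomorph

/-!
# The vertical sphere at infinity `V∞` of the wedge cap as a two-chart `JX`-sphere
(helper `helper_wedgeSphereV` of line `cross-cap-laurent`, crux `GromovRecognitionRelEnd`,
item stmt-SmoothPoincare4-11009)

In the wedge cap `X` with its almost complex structure `JX`, the two cap charts
`ηV : {|(p₀, p₁)| < R₁⁻¹} → X` and `ηC : {|(p₀, p₁)| < R₁⁻¹, |(p₂, p₃)| < R₁⁻¹} → X` are local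
diffeomorphisms on their (open) coordinate domains, intertwine the product structure `i ⊕ i`
of `ℝ⁴ = ℂ²` with `JX` (`JX ∘ dη = dη ∘ rot`, `rot q = (-q₁, q₀, -q₃, q₂)`), and are glued by the
complex inversion of the SECOND factor, `ηC (u, t) = ηV (u, 1/t)` for `t ≠ 0`.  This file
exhibits the sphere at infinity `V∞ = ηV (0 × ℂ) ∪ {ηC 0}` as a `C^∞` `JX`-holomorphic sphere in
two-chart form `u v : ℂ → X`, `v w = u w⁻¹` for `w ≠ 0`:

* `u z := ηV (0, 0, z.re, z.im)` — an affine slice of the holomorphic chart `ηV`, hence `C^∞`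
  and `JX`-holomorphic (file `…StubFlatLeavesAux2`: `contMDiff_comp_slice`,
  `isJHolomorphic_comp_slice`);
* `v w := if w = 0 then ηC (0, 0, 0, 0) else u w⁻¹`; near `0` the gluing clause gives
  `v w = ηC (0, 0, w.re, w.im)` (`inv2_sliceV`: the second inversion acts on the slice as
  `t ↦ 1/t`), so `v` is `C^∞` (`contMDiff_inversionGlue`) and `JX`-holomorphic at `0` (chain
  rule along the slice and the `JX`-clause of `ηC`), while on `{w ≠ 0}` it is locally the
  reparametrisation `u ∘ (w ↦ w⁻¹)` of `u` by a holomorphic map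
  (`Literature.Geometry.Symplectic.IsJHolomorphicOn.comp`); `J`-holomorphicity being a pointwise
  condition on `mfderiv`, it transports along eventual equalities (`mfderiv_congr_point`).

Everything is proved; no definition, no named fact.

References: M. Gromov, *Pseudo holomorphic curves in symplectic manifolds*, Invent. Math. 82
(1985), 2.4.A₁′ [Gromov1985]; C. Hummel, *Gromov's compactness theorem for pseudo-holomorphic
curves* (1997), Ch. I §3 (3.1) [Hummel1997]; D. McDuff, D. Salamon, *J-holomorphic Curves and
Symplectic Topology*, 2nd ed. (2012), §4.2 (spheres through the two charts `z`, `1/z`)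
[McDuffSalamon2012].
-/

noncomputable section

-- the registered namespace `Summit.SmoothPoincare4.SmoothPoincare4.Theorems…` repeats a component
set_option linter.dupNamespace false

open scoped Manifold ContDiff Topology
open Set Function Filter Literature.Geometry.Symplectic

namespace Summit.SmoothPoincare4.SmoothPoincare4.Theorems.GromovRecognitionRelEnd.CrossCapLaurent

namespace WedgeSphereV

open CapModel FlatLeaves

/-- **`J`-holomorphicity at a point transports along eventual equality.** If `v = w` near `z`
and `dw_z (i ζ) = J_{w z} (dw_z ζ)` for all `ζ`, then the same holds for `v` at `z`
(`mfderiv` depends only on the germ). [folklore] -/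
theorem mfderiv_congr_point {E' : Type*} [NormedAddCommGroup E'] [NormedSpace ℝ E']
    {H' : Type*} [TopologicalSpace H'] {I' : ModelWithCorners ℝ E' H'} {X : Type*}
    [TopologicalSpace X] [ChartedSpace H' X]
    {J : ∀ y : X, TangentSpace I' y →L[ℝ] TangentSpace I' y} {v w : ℂ → X} {z : ℂ}
    (hev : v =ᶠ[𝓝 z] w)
    (hw : ∀ ζ : ℂ, mfderiv 𝓘(ℝ, ℂ) I' w z (Complex.I * ζ : ℂ) =
      J (w z) (mfderiv 𝓘(ℝ, ℂ) I' w z (ζ : ℂ))) (ζ : ℂ) :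
    mfderiv 𝓘(ℝ, ℂ) I' v z (Complex.I * ζ : ℂ) = J (v z) (mfderiv 𝓘(ℝ, ℂ) I' v z (ζ : ℂ)) := by
  have hvz : v z = w z := hev.self_of_nhds
  rw [hev.mfderiv_eq, hvz]
  exact hw ζ

end WedgeSphereV

open CapModel FlatLeaves WedgeSphereV in
/-- **Registered helper `helper_wedgeSphereV`** (line `cross-cap-laurent`, signature verbatim):
the vertical sphere at infinity `V∞ = ηV (0 × ℂ) ∪ {ηC 0}` of the wedge cap is a `C^∞`
`JX`-holomorphic sphere in two-chart form, `u z = ηV (0, 0, z)`, `v w = u w⁻¹` (`w ≠ 0`),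
`v 0 = ηC 0`.  See the file header for the proof. [cite: Gromov1985, 2.4.A₁′] -/
theorem helper_wedgeSphereV : ∀ (X : Type) [TopologicalSpace X] [ChartedSpace (EuclideanSpace ℝ (Fin 4)) X] [IsManifold (𝓡 4) ∞ X] (JX : Literature.Geometry.Symplectic.AlmostComplexStructure (𝓡 4) ∞ X) (R₁ : ℝ) (ηV ηC : EuclideanSpace ℝ (Fin 4) → X), 0 < R₁ → IsLocalDiffeomorphOn 𝓘(ℝ, EuclideanSpace ℝ (Fin 4)) (𝓡 4) ∞ ηV {p : EuclideanSpace ℝ (Fin 4) | p 0 ^ 2 + p 1 ^ 2 < R₁⁻¹ ^ 2} → (∀ p : EuclideanSpace ℝ (Fin 4), p 0 ^ 2 + p 1 ^ 2 < R₁⁻¹ ^ 2 → ∀ q : EuclideanSpace ℝ (Fin 4), JX (ηV p) (mfderiv 𝓘(ℝ, EuclideanSpace ℝ (Fin 4)) (𝓡 4) ηV p q) = mfderiv 𝓘(ℝ, EuclideanSpace ℝ (Fin 4)) (𝓡 4) ηV p (WithLp.toLp 2 ![-(q 1), q 0, -(q 3), q 2])) → IsLocalDiffeomorphOn 𝓘(ℝ,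 EuclideanSpace ℝ (Fin 4)) (𝓡 4) ∞ ηC {p : EuclideanSpace ℝ (Fin 4) | p 0 ^ 2 + p 1 ^ 2 < R₁⁻¹ ^ 2 ∧ p 2 ^ 2 + p 3 ^ 2 < R₁⁻¹ ^ 2} → (∀ p : EuclideanSpace ℝ (Fin 4), p 0 ^ 2 + p 1 ^ 2 < R₁⁻¹ ^ 2 → p 2 ^ 2 + p 3 ^ 2 < R₁⁻¹ ^ 2 → (p 2 ≠ 0 ∨ p 3 ≠ 0) → ηC p = ηV (WithLp.toLp 2 ![p 0, p 1, p 2 / (p 2 ^ 2 + p 3 ^ 2), -(p 3) / (p 2 ^ 2 + p 3 ^ 2)])) → (∀ p : EuclideanSpace ℝ (Fin 4), p 0 ^ 2 + p 1 ^ 2 < R₁⁻¹ ^ 2 → p 2 ^ 2 + p 3 ^ 2 < R₁⁻¹ ^ 2 → ∀ q : EuclideanSpace ℝ (Fin 4), JX (ηC p) (mfderiv 𝓘(ℝ, EuclideanSpace ℝ (Fin 4)) (𝓡 4) ηC p q) = mfderiv 𝓘(ℝ, EuclideanSpace ℝ (Fin 4)) (𝓡 4) ηC p (WithLp.toLp 2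 ![-(q 1), q 0, -(q 3), q 2])) → ∃ u v : ℂ → X, ContMDiff 𝓘(ℝ, ℂ) (𝓡 4) ∞ u ∧ ContMDiff 𝓘(ℝ, ℂ) (𝓡 4) ∞ v ∧ (∀ w : ℂ, w ≠ 0 → v w = u w⁻¹) ∧ Literature.Geometry.Symplectic.IsJHolomorphic (𝓡 4) (fun y => JX y) u ∧ Literature.Geometry.Symplectic.IsJHolomorphic (𝓡 4) (fun y => JX y) v ∧ (∀ z : ℂ, u z = ηV (WithLp.toLp 2 ![0, 0, z.re, z.im])) ∧ v 0 = ηC 0 := by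
  intro X _ _ _ JX R₁ ηV ηC hR₁ hVloc hVhol hCloc hCV hChol
  classical
  -- the slice inclusion `ζ ↦ (0, 0, ζ)` as a real-linear map intertwining `i` with `i ⊕ i`
  obtain ⟨T, hT, hTI⟩ := exists_clm_slice23
  -- the two coordinate domains
  set DV : Set (EuclideanSpace ℝ (Fin 4)) :=
    {p : EuclideanSpace ℝ (Fin 4) | p 0 ^ 2 + p 1 ^ 2 < R₁⁻¹ ^ 2} with hDV
  set DC : Set (EuclideanSpace ℝ (Fin 4)) :=
    {p : EuclideanSpace ℝ (Fin 4) | p 0 ^ 2 + p 1 ^ 2 < R₁⁻¹ ^ 2 ∧ p 2 ^ 2 + p 3 ^ 2 < R₁⁻¹ ^ 2}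
    with hDC
  have hR : (0 : ℝ) < R₁⁻¹ ^ 2 := by positivity
  -- the slice `s t = (0, 0, t)` and its coordinates
  set s : ℂ → EuclideanSpace ℝ (Fin 4) := fun t => WithLp.toLp 2 ![0, 0, t.re, t.im] with hs
  have hs_fd : ∀ t, HasFDerivAt s T t := hasFDerivAt_slice23 hT 0 0
  have hs0 : ∀ t, s t 0 = 0 := fun t => by simp [hs]
  have hs1 : ∀ t, s t 1 = 0 := fun t => by simp [hs]
  have hs2 : ∀ t, s t 2 = t.re := fun t => by simp [hs]
  have hs3 : ∀ t, s t 3 = t.im := fun t => by simp [hs]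
  have hsDV : ∀ t, s t ∈ DV := fun t => by
    show s t 0 ^ 2 + s t 1 ^ 2 < R₁⁻¹ ^ 2
    rw [hs0, hs1]; simpa using hR
  have hsDC : ∀ t : ℂ, Complex.normSq t < R₁⁻¹ ^ 2 → s t ∈ DC := fun t ht =>
    ⟨hsDV t, by show r2 (s t) < R₁⁻¹ ^ 2; rw [hs, r2_sliceV]; exact ht⟩
  have hs00 : s 0 = 0 := by
    ext i
    fin_cases i <;> simp [hs]
  have hinv2s : ∀ t, inv2 (s t) = s t⁻¹ := fun t => inv2_sliceV _ _ t
  -- the first affine chart `u = ηV ∘ s`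
  set u : ℂ → X := fun t => ηV (s t) with hu
  have hVD : ∀ p ∈ DV, ContMDiffAt 𝓘(ℝ, EuclideanSpace ℝ (Fin 4)) (𝓡 4) ∞ ηV p := fun p hp =>
    contMDiffAt_of_mem hVloc hp
  have hu_smooth : ContMDiff 𝓘(ℝ, ℂ) (𝓡 4) ∞ u := contMDiff_comp_slice hVD hs_fd hsDV
  have hu_hol : IsJHolomorphic (𝓡 4) (fun y => JX y) u :=
    isJHolomorphic_comp_slice (fun p hp => (hVD p hp).mdifferentiableAt (by simp))
      (fun p hp q => hVhol p hp q) hs_fd hTI hsDV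
  -- the second affine chart `v = u (1/t)`, `v 0 = ηC 0`
  set v : ℂ → X := fun t => if t = 0 then ηC (s 0) else u t⁻¹ with hv
  have hCt : ∀ t : ℂ, Complex.normSq t < R₁⁻¹ ^ 2 → t ≠ 0 → ηC (s t) = u t⁻¹ := by
    intro t ht ht0
    have h23 : s t 2 ≠ 0 ∨ s t 3 ≠ 0 := by
      rw [hs2, hs3]
      by_contra hc
      simp only [not_or, not_not] at hc
      exact ht0 (Complex.ext hc.1 hc.2)
    rw [hCV (s t) (hsDC t ht).1 (hsDC t ht).2 h23]
    show ηV (inv2 (s t)) = ηV (s t⁻¹)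
    rw [hinv2s]
  have hCD0 : ContMDiffAt 𝓘(ℝ, EuclideanSpace ℝ (Fin 4)) (𝓡 4) ∞ ηC (s 0) :=
    contMDiffAt_of_mem hCloc (hsDC 0 (by simpa using hR))
  have hC0s : ContMDiffAt 𝓘(ℝ, ℂ) (𝓡 4) ∞ (fun t => ηC (s t)) 0 :=
    hCD0.comp 0 (contDiff_of_hasFDerivAt_const hs_fd).contMDiff.contMDiffAt
  have hagree : ∀ᶠ t in 𝓝 (0 : ℂ), t ≠ 0 → ηC (s t) = u t⁻¹ :=
    (eventually_normSq_lt hR).mono fun t ht ht0 => hCt t ht ht0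
  have hv_smooth : ContMDiff 𝓘(ℝ, ℂ) (𝓡 4) ∞ v := contMDiff_inversionGlue hu_smooth hC0s hagree
  have huv : ∀ t : ℂ, t ≠ 0 → v t = u t⁻¹ := fun t ht => if_neg ht
  have hv0' : v 0 = ηC (s 0) := if_pos rfl
  have hv0 : v 0 = ηC 0 := by rw [hv0', hs00]
  -- `v` is `JX`-holomorphic: at `0` through the slice `ηC ∘ s`, elsewhere through `u ∘ (1/·)`
  have hv_hol : IsJHolomorphic (𝓡 4) (fun y => JX y) v := by
    intro z ζ
    by_cases hz : z = 0
    · subst hz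
      have hev : v =ᶠ[𝓝 0] fun t => ηC (s t) := by
        filter_upwards [hagree] with t ht
        by_cases ht0 : t = 0
        · subst ht0
          exact hv0'
        · rw [huv t ht0]
          exact (ht ht0).symm
      have hCmd : MDifferentiableAt 𝓘(ℝ, EuclideanSpace ℝ (Fin 4)) (𝓡 4) ηC (s 0) :=
        hCD0.mdifferentiableAt (by simp)
      refine mfderiv_congr_point hev (fun ξ => ?_) ζ
      rw [mfderiv_comp_slice_apply (hs_fd 0) hCmd, mfderiv_comp_slice_apply (hs_fd 0) hCmd, hTI]
      exact (hChol (s 0) (hsDC 0 (by simpa using hR)).1 (hsDC 0 (by simpa using hR)).2 (T ξ)).symm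
    · have hev : v =ᶠ[𝓝 z] (u ∘ fun t : ℂ => t⁻¹) := by
        filter_upwards [isOpen_ne.mem_nhds hz] with t ht
        exact huv t ht
      have hcomp : IsJHolomorphicOn (𝓡 4) (fun y => JX y) (u ∘ fun t : ℂ => t⁻¹) {t : ℂ | t ≠ 0} :=
        (hu_hol.isJHolomorphicOn univ).comp isOpen_ne differentiableOn_inv (mapsTo_univ _ _)
          fun t _ => (hu_smooth t⁻¹).mdifferentiableAt (by simp)
      exact mfderiv_congr_point hev (hcomp z hz) ζ
  exact ⟨u, v, hu_smooth, hv_smooth, huv, hu_hol, hv_hol, fun z => rfl, hv0⟩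

end Summit.SmoothPoincare4.SmoothPoincare4.Theorems.GromovRecognitionRelEnd.CrossCapLaurent
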